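/-
Origin: expansion seat `planner-pub-hodgecm-pv09-g4-0`, handover #16 2026-08-18T08:18:33Z (`HOME/pub-hodgecm-pv09-g4/lean/Pv09g4/GenuineSetUp.lean`, md5 9481eab0, 63 lines);
landed by the gen-7 packager in gate run 26 as `HodgeCM/PerL34/GenuineSetUp.lean` (import ^import Pv[0-9]+g[0-9]+\.→import HodgeCM.PerL34. ×2).
-/
/-
HodgeCM / PerL34 publication cell — seam S3 set-up, model side (pub-hodgecm-pv09-g4, HANDOVER #16).
WIP imports: `Pv09g4.ModelTransport` ↦ `HodgeCM.PerL34.ModelTransport` (run 26, my #8),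
`Pv09g4.UnitaryPoints` ↦ `HodgeCM.PerL34.UnitaryPoints` (#15).
Complete proofs, no new axioms, nothing cited.
-/
import Summits.HodgeConjecture.HodgeCM.PerL34.ModelTransport
import Summits.HodgeConjecture.HodgeCM.PerL34.UnitaryPoints

/-!
# The S3 set-up instances for the GENUINE torus `U(1)_{L/L⁺}(𝔸_{L⁺}) ⊇ U(L)`

`RallisAdicEnd` / `RallisHeadline` quantify over an abstract restricted product `A = Πʳ_i [G_i, B_i]`, an abstract
`jA : unitary L →* A`, and the INSTANCE hypotheses `[DiscreteTopology jA.range]`, `[CompactSpace (A ⧸ jA.range)]`.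
For a CM field `L` these are now THEOREMS for the genuine objects: `A :=` the place-indexed restricted-product
model `Πʳ_{v ∈ Place L⁺} [locTorus L⁺ L v, …]` of pv11-g4's `relNormOneIdeles L⁺ L` (#14 `torusEquiv`) and
`jA := unitaryToModel L` (#15), transported along `e := (torusEquiv L⁺ L).symm` by #8
`ModelTransport.instances_of_modelEquiv` from pv11-g4's kernel theorems (`L¹` discrete, `U(1)(𝔸)/L¹` compact).
-/

set_option autoImplicit false

noncomputable section

open NumberField
open scoped RestrictedProduct

namespace HodgeCM.PerL34.IdelicTorusModel

open IdelePlaces RestrictedRegroup RestrictedCutout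

variable (L : Type) [Field L] [NumberField L] [IsCMField L]

/-- The place-indexed model of `U(1)_{L/L⁺}(𝔸_{L⁺})`: `Πʳ_v [U_v, U_v ∩ Π_{w ∣ v} 𝒪_wˣ]`. -/
abbrev Model : Type :=
  Πʳ k : Place (maximalRealSubfield L), [locTorus (maximalRealSubfield L) L k,
    inH (fun k => fibSubgroup (intUnits L) (pl (maximalRealSubfield L) L) k) (locTorus (maximalRealSubfield L) L) k]

/-- (Ported verbatim from the HodgeCMPerL package; no docstring in the source.) -/
theorem setUp_instances :
    DiscreteTopology ((unitaryToModel L).range : Subgroup (Model L)) ∧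
      CompactSpace (Model L ⧸ ((unitaryToModel L).range : Subgroup (Model L))) :=
  DiscreteFD.instances_of_modelEquiv
    (fun k => inH (fun k => fibSubgroup (intUnits L) (pl (maximalRealSubfield L) L) k)
      (locTorus (maximalRealSubfield L) L) k)
    (unitaryToModel L) (maximalRealSubfield L) L (torusEquiv (maximalRealSubfield L) L).symm
    (torusEquiv_symm_unitaryToModel_mem L) (fun _ ha => torusEquiv_mem_range_unitaryToModel L ha)

/-- **`Γ = U(L)` is discrete in the genuine `A = U(1)_{L/L⁺}(𝔸_{L⁺})`** (place-indexed model). -/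
instance discreteTopology_range_unitaryToModel :
    DiscreteTopology ((unitaryToModel L).range : Subgroup (Model L)) :=
  (setUp_instances L).1

/-- **`A ⧸ Γ` is compact for the genuine `A = U(1)_{L/L⁺}(𝔸_{L⁺}) ⊇ U(L)`** (place-indexed model). -/
instance compactSpace_quotient_range_unitaryToModel :
    CompactSpace (Model L ⧸ ((unitaryToModel L).range : Subgroup (Model L))) :=
  (setUp_instances L).2

example : IsTopologicalGroup (Model L) := inferInstance
example : T2Space (relNormOneIdeles (maximalRealSubfield L) L) := inferInstance

end HodgeCM.PerL34.IdelicTorusModel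

end
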